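import Summits.PneNP.PneNP.Theorems.ExpanderLinearGeneratorsResolutionNFreeMaster
import HarnessLib

/-!
# The n-free resolution-size rung for expanding linear systems, X: altered restrictions

Support file for crux `stmt-PneNP-11442`
(`Summit.PneNP.PneNP.Theses.ExpanderLinearGenerators.ExpansionForcesDepthFregeSize`). The
deterministic combinatorics of the ALTERATION step that upgrades the n-free polynomial
resolution-size law (files I–IV) to an n-free EXPONENTIAL law at bounded column weight
(file XII):

* `card_inter_alter_le`: removing from an assigned set `A` all variables of the rows OVERLOADED by
  `A` (more than `L` assigned variables) leaves every row with load `≤ L`;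
* `exists_unsatisfied_wide_line_alter`: hence file I applies to the altered restriction of EVERY
  sample — some line of the refutation stays unsatisfied with `> W` unassigned literals;
* `mul_card_add_card_boundary_le`: if all rows of a family `F` are overloaded by `A` then
  `(L+1)|F| + |∂F| ≤ |∂F ∩ A| + Σ_{i ∈ F} |S i|` (double counting of incidences: non-boundary
  points absorb at most `Σ|S i| - |∂F|` of the `(L+1)|F|` assigned incidences) — with expansion
  `|∂F| ≥ c|F|` and sparsity this forces `≥ (L + 1 + c - ℓ)|F|` assigned BOUNDARY points, an event
  of probability `≤ (2^ℓ p^{L+1+c-ℓ})^{|F|}` however the rows of `F` overlap;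
* `exists_overloaded_family`: if more than `ℓ (s - 1)` points of a set are covered by overloaded
  rows of support `≤ ℓ`, some `s` DISTINCT overloaded rows meet the set (greedy extraction).

References: N. Alon, J. Spencer, *The probabilistic method*, §3 (alteration); E. Ben-Sasson,
A. Wigderson, J. ACM 48 (2001), §3, §6; P. Beame, T. Pitassi, FOCS 1996.
-/

namespace Summit.PneNP.PneNP.Theorems.ResNFree

set_option linter.dupNamespace false -- `Summit.PneNP.PneNP.…`: summit = sub-problem (D-0017)

open Finset Literature.Computability.Complexity Literature.Computability.MetaComplexity
open Summit.PneNP.PneNP.Theorems.ResKRestriction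

variable {m n : ℕ}

/-! ### Alteration restores bounded loads -/

/-- **Alteration restores bounded loads.** Remove from `A` every variable of every row overloaded
by `A` (at least `L + 1` assigned variables); then every row meets the altered set in at most `L`
variables. [Alon–Spencer, §3 (alteration)] [folklore] -/
theorem card_inter_alter_le (E : Fin m → LinEqMod 2 n) (A : Finset ℕ) (L : ℕ) (k : Fin m) :
    ((rowVars E k) ∩ (A \ cover (rowVars E)
      ((univ : Finset (Fin m)).filter fun i => L + 1 ≤ ((rowVars E i) ∩ A).card))).card ≤ L := by
  classical
  set O : Finset (Fin m) := univ.filter fun i => L + 1 ≤ ((rowVars E i) ∩ A).card with hO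
  by_cases hk : k ∈ O
  · have h0 : (rowVars E k) ∩ (A \ cover (rowVars E) O) = ∅ := by
      rw [Finset.eq_empty_iff_forall_notMem]
      intro v hv
      rw [Finset.mem_inter, Finset.mem_sdiff] at hv
      exact hv.2.2 (mem_cover.2 ⟨k, hk, hv.1⟩)
    rw [h0, Finset.card_empty]
    exact Nat.zero_le _
  · have hk' : ¬ L + 1 ≤ ((rowVars E k) ∩ A).card := by
      intro h; exact hk (Finset.mem_filter.2 ⟨Finset.mem_univ _, h⟩)
    have hmono : (rowVars E k) ∩ (A \ cover (rowVars E) O) ⊆ (rowVars E k) ∩ A :=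
      Finset.inter_subset_inter_left (Finset.sdiff_subset)
    have := Finset.card_le_card hmono
    omega

/-- **The core applies to every altered sample.** Let the row supports of `E` form an
`(r, c)`-boundary expander (`r ≥ 2`) and let `π` be a resolution refutation of `sumEncoding 1 E`.
For ANY set `A` of variables, if `ρ` assigns, among the variables `< n`, only variables of the
altered set `A ∖ vars(rows overloaded by A)`, then for every `L < c` and `W < (c - L) r / 2` some
line of `π` is not satisfied by `ρ` and keeps more than `W` literals unassigned.
[Ben-Sasson–Wigderson 2001, §3, Thm. 6.5; Beame–Pitassi 1996; Alon–Spencer §3] [folklore] -/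
theorem exists_unsatisfied_wide_line_alter (E : Fin m → LinEqMod 2 n) {r c : ℝ}
    (hexp : IsBoundaryExpander (rowVars E) r c) (hr : 2 ≤ r) {L W : ℕ} (hcL : (L : ℝ) < c)
    (hW : (W : ℝ) < (c - L) * r / 2) {π : List (ResLine ℕ)}
    (hπ : IsResRefutation (sumEncoding 1 E) π) (A : Finset ℕ) (ρ : ℕ → Option Bool)
    (hρA : ∀ v, v < n → v ∉ A \ cover (rowVars E)
      ((univ : Finset (Fin m)).filter fun i => L + 1 ≤ ((rowVars E i) ∩ A).card) → ρ v = none) :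
    ∃ l ∈ π, ¬ SatisfiedBy ρ l.clause ∧ W < (restrictClause ρ l.clause).card := by
  classical
  have hU : ∀ l ∈ π, l.rule = ResRule.initial →
      ∃ k ∈ (univ : Finset (Fin m)), ∃ cl ∈ equationCNF 1 (E k), cl.toFinset = l.clause := by
    intro l hl hrule
    obtain ⟨k, cl, hcl, hclC⟩ := exists_row_of_initial E hπ hl hrule
    exact ⟨k, Finset.mem_univ _, cl, hcl, hclC⟩
  exact exists_unsatisfied_wide_line E hexp hr hcL hW hπ hU
    (fun k _ => card_inter_alter_le E A L k) ρ hρA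

/-! ### Overloaded families have many assigned boundary points -/

section DoubleCounting

variable {ι : Type*} [DecidableEq ι] (S : ι → Finset ℕ)

/-- The assigned incidences of a family, counted through the cover:
`Σ_{i ∈ F} |S i ∩ A| = Σ_{v ∈ cover F} [v ∈ A] · deg_F(v)`. [folklore] -/
theorem sum_card_inter_eq_sum_cover (F : Finset ι) (A : Finset ℕ) :
    ∑ i ∈ F, ((S i) ∩ A).card
      = ∑ v ∈ cover S F, if v ∈ A then coverDegree S F v else 0 := by
  have h1 : ∀ i ∈ F, ((S i) ∩ A).card
      = ∑ v ∈ cover S F, if v ∈ S i ∧ v ∈ A then 1 else 0 := by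
    intro i hi
    have hset : (S i) ∩ A = (cover S F).filter fun v => v ∈ S i ∧ v ∈ A := by
      ext v
      simp only [Finset.mem_inter, Finset.mem_filter]
      constructor
      · rintro ⟨hv1, hv2⟩; exact ⟨subset_cover hi hv1, hv1, hv2⟩
      · rintro ⟨-, hv1, hv2⟩; exact ⟨hv1, hv2⟩
    rw [hset, Finset.card_filter]
  rw [Finset.sum_congr rfl h1, Finset.sum_comm]
  refine Finset.sum_congr rfl fun v _ => ?_
  by_cases hvA : v ∈ A
  · simp only [hvA, and_true, if_true, coverDegree, Finset.card_filter]
  · simp [hvA]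

/-- **Overloaded families have many assigned boundary points.** If every row of `F` meets `A` in
at least `L + 1` points then `(L+1)|F| + |∂F| ≤ |∂F ∩ A| + Σ_{i ∈ F} |S i|`: the non-boundary
points of the cover absorb at most `Σ|S i| - |∂F|` of the assigned incidences.
[Ben-Sasson–Wigderson 2001, §6 (double counting); Alon–Spencer §3] [folklore] -/
theorem mul_card_add_card_boundary_le (F : Finset ι) (A : Finset ℕ) {L : ℕ}
    (hover : ∀ i ∈ F, L + 1 ≤ ((S i) ∩ A).card) :
    (L + 1) * F.card + (boundary S F).card
      ≤ ((boundary S F) ∩ A).card + ∑ i ∈ F, (S i).card := by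
  -- total assigned incidences
  have hinc : (L + 1) * F.card ≤ ∑ i ∈ F, ((S i) ∩ A).card :=
    calc (L + 1) * F.card = ∑ i ∈ F, (L + 1) := by rw [Finset.sum_const, smul_eq_mul, mul_comm]
      _ ≤ ∑ i ∈ F, ((S i) ∩ A).card := Finset.sum_le_sum hover
  rw [sum_card_inter_eq_sum_cover S F A] at hinc
  -- split the cover into boundary and the rest
  have hbd : boundary S F ⊆ cover S F := boundary_subset_cover F
  have hsplit := Finset.sum_filter_add_sum_filter_not (cover S F)
    (fun v => coverDegree S F v = 1) (fun v => if v ∈ A then coverDegree S F v else 0)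
  have hsplit' := Finset.sum_filter_add_sum_filter_not (cover S F)
    (fun v => coverDegree S F v = 1) (fun v => coverDegree S F v)
  have hfilt : (cover S F).filter (fun v => coverDegree S F v = 1) = boundary S F := rfl
  rw [hfilt] at hsplit hsplit'
  -- on the boundary the degree is one
  have hb1 : ∑ v ∈ boundary S F, (if v ∈ A then coverDegree S F v else 0)
      = ((boundary S F) ∩ A).card := by
    rw [← Finset.filter_mem_eq_inter, Finset.card_filter]
    refine Finset.sum_congr rfl fun v hv => ?_
    rw [(mem_boundary.1 hv).2]
  have hb2 : ∑ v ∈ boundary S F, coverDegree S F v = (boundary S F).card := by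
    rw [Finset.card_eq_sum_ones]
    exact Finset.sum_congr rfl fun v hv => (mem_boundary.1 hv).2
  -- off the boundary, drop the indicator
  have hoff : ∑ v ∈ (cover S F).filter (fun v => ¬ coverDegree S F v = 1),
      (if v ∈ A then coverDegree S F v else 0)
      ≤ ∑ v ∈ (cover S F).filter (fun v => ¬ coverDegree S F v = 1), coverDegree S F v := by
    refine Finset.sum_le_sum fun v _ => ?_
    split_ifs
    · exact le_rfl
    · exact Nat.zero_le _
  have htot : ∑ v ∈ cover S F, coverDegree S F v = ∑ i ∈ F, (S i).card := sum_coverDegree F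
  omega

end DoubleCounting

/-! ### Extracting distinct overloaded rows -/

/-- **Greedy extraction.** If the points of `Dam` are covered by rows of `O` whose supports have
at most `ℓ` points, and `|Dam| > ℓ (s - 1)` (written `ℓ s + 1 ≤ |Dam| + ℓ`, `s ≥ 1`), then some `s`
distinct rows of `O` each meet `Dam`. [folklore] -/
theorem exists_overloaded_family {ℓ : ℕ} (Sp : Fin m → Finset (Fin n)) (hSp : ∀ i, (Sp i).card ≤ ℓ)
    (O : Finset (Fin m)) (s : ℕ) (hs : 1 ≤ s) (Dam : Finset (Fin n))
    (hDam : ℓ * s + 1 ≤ Dam.card + ℓ) (hcov : ∀ j ∈ Dam, ∃ i ∈ O, j ∈ Sp i) :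
    ∃ F : Finset (Fin m), F ⊆ O ∧ F.card = s ∧ ∀ i ∈ F, ∃ j ∈ Dam, j ∈ Sp i := by
  classical
  induction s, hs using Nat.le_induction generalizing Dam with
  | base =>
    have hpos : 0 < Dam.card := by omega
    obtain ⟨j, hj⟩ := Finset.card_pos.1 hpos
    obtain ⟨i, hiO, hji⟩ := hcov j hj
    exact ⟨{i}, Finset.singleton_subset_iff.2 hiO, Finset.card_singleton i,
      fun i' hi' => ⟨j, hj, by rw [Finset.mem_singleton.1 hi']; exact hji⟩⟩
  | succ s hs ih =>
    have hpos : 0 < Dam.card := by nlinarith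
    obtain ⟨j₀, hj₀⟩ := Finset.card_pos.1 hpos
    obtain ⟨i₀, hi₀O, hji₀⟩ := hcov j₀ hj₀
    set Dam' : Finset (Fin n) := Dam.filter fun j => j ∉ Sp i₀ with hDam'
    have hcard : Dam.card ≤ Dam'.card + ℓ := by
      have h1 := Finset.card_filter_add_card_filter_not (s := Dam) (fun j => j ∉ Sp i₀)
      have h2 : (Dam.filter fun j => ¬ (j ∉ Sp i₀)).card ≤ ℓ := by
        refine le_trans (Finset.card_le_card ?_) (hSp i₀)
        intro j hj
        have := (Finset.mem_filter.1 hj).2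
        push Not at this
        exact this
      have h3 : Dam'.card = (Dam.filter fun j => j ∉ Sp i₀).card := rfl
      omega
    have hDam'' : ℓ * s + 1 ≤ Dam'.card + ℓ := by
      have : ℓ * (s + 1) = ℓ * s + ℓ := by ring
      omega
    have hcov' : ∀ j ∈ Dam', ∃ i ∈ O, j ∈ Sp i := fun j hj => hcov j (Finset.mem_filter.1 hj).1
    obtain ⟨F', hF'O, hF'card, hF'meet⟩ := ih Dam' hDam'' hcov'
    have hi₀F' : i₀ ∉ F' := by
      intro h
      obtain ⟨j, hj, hji⟩ := hF'meet i₀ h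
      exact (Finset.mem_filter.1 hj).2 hji
    refine ⟨insert i₀ F', Finset.insert_subset hi₀O hF'O, by rw [Finset.card_insert_of_notMem hi₀F', hF'card], ?_⟩
    intro i hi
    rcases Finset.mem_insert.1 hi with rfl | hi
    · exact ⟨j₀, hj₀, hji₀⟩
    · obtain ⟨j, hj, hji⟩ := hF'meet i hi
      exact ⟨j, (Finset.mem_filter.1 hj).1, hji⟩

end Summit.PneNP.PneNP.Theorems.ResNFree
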